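import Literature.Analysis.FunctionSpaces.TorusPatching
import Literature.Analysis.FunctionSpaces.TorusCalculus
import HarnessLib

/-!
# Building blocks of the Alberti–Crippa–Mazzucato quasi-self-similar family (BDL 2023, §4.1 and
the structural part of Thm. 4.1)

Topic `Literature/Analysis/FluidPDE` (trunk FluidKinetic, family `turb`). Bruè–De Lellis, CMP 400
(2023), Thm. 4.1 asserts two things: (1) the EXISTENCE of `N = 6` building blocks
`(V_i, Θ_i)` on `[0,1]² × [0,1]` satisfying (i)–(iv) of their §4.1 which "can be patched
together" by the formulas (4.3)–(4.4),
`ρ_n = Σ_{Q ∈ 𝒬(2·5ⁿ)} χ_Q Θ_{i(Q)}(2·5ⁿ(· - r(Q)), t)`,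
`v_n = Σ_Q χ_Q (2·5ⁿ)⁻¹ V_{i(Q)}(2·5ⁿ(· - r(Q)), t)`, into a family of SMOOTH solutions with
compact supports in `(0,1)²` and the hand-over `ρ_n(1) = ρ_{n+1}(0)`; and (2) the ESTIMATES
(a), (b) and (4.10) for that family. Part (1) is the geometric/combinatorial heart of
Alberti–Crippa–Mazzucato, JAMS 32 (2019), §§7–8 (the "Peano snake": canonical velocity field and
solution attached to two time-dependent curves `Γ₁`, `Γ₂` plus their rotations, and the
matching of adjacent blocks near the interfaces, §8.6), whose curves are given in the source
only pictorially (§8.9–8.11: "Due to the complexity that a rigorous construction would entail,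
we only give a precise description of the initial states … and of the final states … and sketch
some of the intermediate states"). Part (2) is the scaling analysis of ACM §6 (Lemma 18, §6.4),
an honest computation.

This file vendors part (1) as the named fact `acm_building_blocks`, phrased with the accepted
patching operator `Torus.patchTorus` (`TorusPatching.lean`), so that part (2) can be PROVED
from it (`QuasiSelfSimilarFamilyProofs.lean`: `acm_building_blocks → alberti_crippa_mazzucato_family`).

## Lean rendering

* A building-block family (`QuasiSelfSimilar.IsBuildingBlockFamily`, BDL §4.1 (i)–(iv)):
  blocks are maps `V_i : ℝ → ℝ² → ℝ²`, `Θ_i : ℝ → ℝ² → ℝ` (time first), jointly `C^∞` on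
  `ℝ × ℝ²` — the printed `C^∞([0,1]² × [0,1])` means smooth up to the boundary, i.e. the
  restriction of a smooth function on `ℝ³` (Seeley extension), and ACM's blocks are anyway
  defined on `[0,1] × ℝ²` (ACM Prop. 21) and can be made flat in time near `t = 0, 1` (ACM §3.3, §8.8); the
  properties (i)–(iii) are required on `[0,1] × [0,1]²` (closed square `closedSquare`),
  (iv) on the open subsquares of side `1/5` as printed; divergence and transport are written
  with Fréchet derivatives on `ℝ²` (`Σⱼ (D V_i(t)(z) eⱼ)ⱼ = 0`,
  `∂ₜΘ_i + DΘ_i(t)(z)[V_i(t,z)] = 0`); (ii) is `∫_{[0,1)²} Θ_i(t) = 0`, `∫_{[0,1)²} Θ_i(t)² = 1`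
  (half-open = open = closed square up to null sets); in addition `|Θ_i| ≤ 10` on
  `[0,1] × [0,1]²`, which is BDL (b) `‖ρ_n‖_∞ ≤ 10` read on the blocks (in the source `N = 6`
  and all six blocks — two rotations of the straight channel, four of the bent one — occur in the
  patching, so (b) bounds each of them; the fact below only asserts `∃ N`, a weakening).
* The patched family (`QuasiSelfSimilar.scalar`, `QuasiSelfSimilar.velocity`): BDL (4.3)–(4.4)
  with mesh `mₙ = 2·5ⁿ` (`QuasiSelfSimilar.mesh`) and level-`n` labels `ι n : ℤ² → Fin N`
  (only the labels of the `4·25ⁿ` cells of `[0,1)²` matter), through `Torus.patchTorus`, i.e.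
  directly as fields on `T² = UnitAddTorus (Fin 2)`; BDL's `χ_Q` over open squares leaves the
  (null) interfaces undefined, the patch uses half-open squares and the asserted smoothness makes
  the choice immaterial.
* The fact asserts, for some blocks and labels: the patched `ρ_n`, `v_n` are jointly smooth on
  `[0,1] × T²` (`Torus.IsSmoothSpaceTimeOn (Icc 0 1)`; BDL Thm. 4.1: "a family of smooth
  solutions"; ACM §8.6–8.8), vanish outside a compact `K_n ⊂ (0,1)²` of the fundamental square
  (BDL (c) in its per-level reading, see `alberti_crippa_mazzucato_family`; ACM §8.6), and hand
  over, `ρ_n(1) = ρ_{n+1}(0)` (BDL (d)). Transport, incompressibility, (a), (b), (4.10) are NOT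
  asserted: they follow (`QuasiSelfSimilarFamilyProofs.lean`).

## References

* E. Bruè, C. De Lellis, *Anomalous dissipation for the forced 3D Navier–Stokes equations*,
  Comm. Math. Phys. 400 (2023), 1507–1533, §4.1 (i)–(iv), Thm. 4.1, (4.3)–(4.4) (arXiv p. 9).
* G. Alberti, G. Crippa, A. L. Mazzucato, *Exponential self-similar mixing by incompressible
  flows*, J. Amer. Math. Soc. 32 (2019), 445–490, Ass. 6.1, §6.2–6.3, Prop. 21, §8 (§8.1
  conditions (a)–(e), §8.4–8.11).
-/

noncomputable section

open MeasureTheory Set Filter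
open scoped ContDiff

namespace Literature.Analysis.FluidPDE

namespace QuasiSelfSimilar

open FunctionSpaces FunctionSpaces.Torus

/-- The closed unit square `[0,1]² ⊂ ℝ²`, domain of the building blocks (BDL 2023, §4.1). [cite: BrueDeLellisCMP2023, §4.1] -/
def closedSquare : Set (EuclideanSpace ℝ (Fin 2)) := {z | ∀ k, z k ∈ Icc (0 : ℝ) 1}

/-- The open unit square `(0,1)² ⊂ ℝ²` (BDL 2023, Thm. 4.1 (c): supports in a compact subset of
`(0,1)²`). [cite: BrueDeLellisCMP2023, Thm. 4.1 (c)] -/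
def openSquare : Set (EuclideanSpace ℝ (Fin 2)) := {z | ∀ k, z k ∈ Ioo (0 : ℝ) 1}

/-- **Building blocks** (Bruè–De Lellis 2023, §4.1 (i)–(iv), with the sup bound of Thm. 4.1 (b)
read blockwise): a finite family of velocity fields `V_i` and scalars `Θ_i`, `i < N`, jointly
smooth (time first; smooth on `ℝ × ℝ²`, the normalisation of "`C^∞([0,1]² × [0,1])`"), such that
on `[0,1] × [0,1]²`: (i) `V_i(t)` is divergence free and tangent to `∂[0,1]²`; (ii) `Θ_i(t)` has
zero mean and unit `L²` norm on the square; (iii) `∂ₜΘ_i + V_i·∇Θ_i = 0`; (iv) for every open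
square `Q` of side `1/5` of the square there is `j = j(Q,i)` with
`Θ_i(z,1) = Θ_j(5(z - r(Q)), 0)` for `z ∈ Q`; and `|Θ_i| ≤ 10`. [cite: BrueDeLellisCMP2023, §4.1 (i)–(iv)] -/
structure IsBuildingBlockFamily {N : ℕ}
    (V : Fin N → ℝ → EuclideanSpace ℝ (Fin 2) → EuclideanSpace ℝ (Fin 2))
    (Θ : Fin N → ℝ → EuclideanSpace ℝ (Fin 2) → ℝ) : Prop where
  /-- (i) `V_i ∈ C^∞` (jointly in `(t, z)`). -/
  smooth_velocity : ∀ i, ContDiff ℝ ∞ (Function.uncurry (V i))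
  /-- (ii) `Θ_i ∈ C^∞` (jointly in `(t, z)`). -/
  smooth_scalar : ∀ i, ContDiff ℝ ∞ (Function.uncurry (Θ i))
  /-- (i) `div V_i(t) = Σⱼ ∂ⱼ (V_i)ⱼ = 0` on `[0,1] × [0,1]²`. -/
  divFree : ∀ i, ∀ t ∈ Icc (0 : ℝ) 1, ∀ z ∈ closedSquare,
    ∑ j, fderiv ℝ (V i t) z (EuclideanSpace.single j 1) j = 0
  /-- (i) `V_i(t)` is tangent to `∂[0,1]²`: the normal component vanishes on the faces. -/
  tangent : ∀ i, ∀ t ∈ Icc (0 : ℝ) 1, ∀ z ∈ closedSquare, ∀ j, (z j = 0 ∨ z j = 1) → V i t z j = 0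
  /-- (ii) zero mean on the square. -/
  zeroMean : ∀ i, ∀ t ∈ Icc (0 : ℝ) 1, ∫ z in unitCube (Fin 2), Θ i t z = 0
  /-- (ii) unit `L²` norm on the square. -/
  unitL2 : ∀ i, ∀ t ∈ Icc (0 : ℝ) 1, ∫ z in unitCube (Fin 2), Θ i t z ^ 2 = 1
  /-- (iii) transport: `∂ₜΘ_i(t,z) + DΘ_i(t)(z)[V_i(t,z)] = 0` on `[0,1] × [0,1]²`. -/
  transport : ∀ i, ∀ t ∈ Icc (0 : ℝ) 1, ∀ z ∈ closedSquare,
    deriv (fun s => Θ i s z) t + fderiv ℝ (Θ i t) z (V i t z) = 0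
  /-- (iv) quasi-self-similarity at scale `1/5`. -/
  selfSimilar : ∀ i, ∀ p : Fin 2 → Fin 5, ∃ j : Fin N,
    ∀ z ∈ latticeCellInterior 5 (fun k => ((p k : ℕ) : ℤ)),
      Θ i 1 z = Θ j 0 ((5 : ℝ) • z - latticeVec fun k => ((p k : ℕ) : ℤ))
  /-- Thm. 4.1 (b), first estimate, blockwise: `|Θ_i| ≤ 10` on `[0,1] × [0,1]²`. -/
  abs_le : ∀ i, ∀ t ∈ Icc (0 : ℝ) 1, ∀ z ∈ closedSquare, |Θ i t z| ≤ 10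

/-- The mesh of level `n`: `mₙ = 2·5ⁿ` squares per side (BDL 2023, (4.3): `𝒬(2·5ⁿ)`). [cite: BrueDeLellisCMP2023, (4.3)] -/
def mesh (n : ℕ) : ℕ := 2 * 5 ^ n

/-- `mₙ = 2·5ⁿ ≥ 1`. [folklore] -/
theorem mesh_pos (n : ℕ) : 0 < mesh n := by unfold mesh; positivity

/-- `mₙ` as a real number. [folklore] -/
theorem cast_mesh (n : ℕ) : (mesh n : ℝ) = 2 * 5 ^ n := by simp [mesh]

/-- **The patched scalar** `ρ_n(t) = Σ_{Q ∈ 𝒬(2·5ⁿ)} χ_Q Θ_{ι(Q)}(2·5ⁿ(· - r(Q)), t)` on `T²`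
(Bruè–De Lellis 2023, (4.3)), with level-`n` labels `ι n : ℤ² → Fin N`. [cite: BrueDeLellisCMP2023, (4.3)] -/
def scalar {N : ℕ} (Θ : Fin N → ℝ → EuclideanSpace ℝ (Fin 2) → ℝ) (ι : ℕ → (Fin 2 → ℤ) → Fin N)
    (n : ℕ) : ℝ → UnitAddTorus (Fin 2) → ℝ :=
  fun t => patchTorus (mesh n) (ι n) fun i => Θ i t

/-- **The patched velocity** `v_n(t) = Σ_{Q ∈ 𝒬(2·5ⁿ)} χ_Q (2·5ⁿ)⁻¹ V_{ι(Q)}(2·5ⁿ(· - r(Q)), t)`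
on `T²` (Bruè–De Lellis 2023, (4.4)). [cite: BrueDeLellisCMP2023, (4.4)] -/
def velocity {N : ℕ} (V : Fin N → ℝ → EuclideanSpace ℝ (Fin 2) → EuclideanSpace ℝ (Fin 2))
    (ι : ℕ → (Fin 2 → ℤ) → Fin N) (n : ℕ) : ℝ → UnitAddTorus (Fin 2) → EuclideanSpace ℝ (Fin 2) :=
  fun t x => ((mesh n : ℝ)⁻¹) • patchTorus (mesh n) (ι n) (fun i => V i t) x

/-- Unfolding `scalar`. [folklore] -/
theorem scalar_apply {N : ℕ} (Θ : Fin N → ℝ → EuclideanSpace ℝ (Fin 2) → ℝ)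
    (ι : ℕ → (Fin 2 → ℤ) → Fin N) (n : ℕ) (t : ℝ) (x : UnitAddTorus (Fin 2)) :
    scalar Θ ι n t x = patchTorus (mesh n) (ι n) (fun i => Θ i t) x := rfl

/-- Unfolding `velocity`. [folklore] -/
theorem velocity_apply {N : ℕ} (V : Fin N → ℝ → EuclideanSpace ℝ (Fin 2) → EuclideanSpace ℝ (Fin 2))
    (ι : ℕ → (Fin 2 → ℤ) → Fin N) (n : ℕ) (t : ℝ) (x : UnitAddTorus (Fin 2)) :
    velocity V ι n t x = ((mesh n : ℝ)⁻¹) • patchTorus (mesh n) (ι n) (fun i => V i t) x := rfl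

end QuasiSelfSimilar

open QuasiSelfSimilar FunctionSpaces

/-- **Alberti–Crippa–Mazzucato building blocks and their patching** (the structural content of
Bruè–De Lellis, CMP 400 (2023), Thm. 4.1, after Alberti–Crippa–Mazzucato, JAMS 32 (2019), §8):
there are finitely many building blocks `(V_i, Θ_i)_{i<N}` in the sense of
`QuasiSelfSimilar.IsBuildingBlockFamily` (BDL §4.1 (i)–(iv), `N = 6` in the source) and, for
every level `n`, labels `ι n(Q) ∈ {0,…,N-1}` of the squares `Q ∈ 𝒬(2·5ⁿ)` such that the patched
fields `ρ_n`, `v_n` of BDL (4.3)–(4.4) (`QuasiSelfSimilar.scalar`, `QuasiSelfSimilar.velocity`)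
are jointly `C^∞` on `[0,1] × T²` (BDL Thm. 4.1: "a family of smooth solutions"; ACM §8.6–8.8:
adjacent blocks coincide near the interfaces), vanish outside a compact subset `K_n` of the open
square `(0,1)²` of the fundamental domain for every `t ∈ [0,1]` (BDL Thm. 4.1 (c), per level;
ACM §8.6: "`u` vanishes in a neighborhood of the boundary"), and hand over:
`ρ_n(·,1) = ρ_{n+1}(·,0)` (BDL Thm. 4.1 (d)). The estimates (a), (b), (4.10) of BDL Thm. 4.1 are
consequences (scaling analysis, ACM §6) and are proved from this fact, not assumed. The source of
the construction gives the two generating curves only by figures (ACM §8.9–8.11).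
[cite: BrueDeLellisCMP2023, Thm. 4.1, (4.3)–(4.4)] [cite: AlbertiCrippaMazzucato2019, §8 (Peano snake), §6.3] -/
def acm_building_blocks : Prop :=
  ∃ (N : ℕ) (V : Fin N → ℝ → EuclideanSpace ℝ (Fin 2) → EuclideanSpace ℝ (Fin 2))
    (Θ : Fin N → ℝ → EuclideanSpace ℝ (Fin 2) → ℝ) (ι : ℕ → (Fin 2 → ℤ) → Fin N),
    IsBuildingBlockFamily V Θ ∧
    (∀ n, Torus.IsSmoothSpaceTimeOn (Icc 0 1) (scalar Θ ι n) ∧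
      Torus.IsSmoothSpaceTimeOn (Icc 0 1) (velocity V ι n)) ∧
    (∀ n, ∃ K : Set (EuclideanSpace ℝ (Fin 2)), IsCompact K ∧ K ⊆ openSquare ∧
      ∀ t ∈ Icc (0 : ℝ) 1, ∀ y ∈ Torus.unitCube (Fin 2), y ∉ K →
        velocity V ι n t (Torus.proj y) = 0 ∧ scalar Θ ι n t (Torus.proj y) = 0) ∧
    (∀ n, scalar Θ ι n 1 = scalar Θ ι (n + 1) 0)

end Literature.Analysis.FluidPDE
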